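import Summits.AnomalousDissipation.AnomalousDissipation.Theorems.SawtoothPulseCascadeK1LocalisedCascadeCTScalars

/-!
# K1loc, line `Spectral` — helper: THE REAL SYMMETRY OF THE CORNER TRACES (S-D, sign-split CT blocks)

For a REAL input `b` (`𝓕b(−k) = conj 𝓕b(k)`), a real even multiplier `χ` on the symmetric source interval `[−Q, Q]`, the
fibre traces `T_n(y) = Σ_l χ_l 𝓕b(l,n) e^{2πily}` (V indexing; `𝓕b(n,l)` for H) satisfy `T_{−n}(y) = conj T_n(y)`, so on a
sign-symmetric fibre set `F` the positive and the negative halves of `Σ_{n∈F}|T_n(y)|²` are equal and each is at most half of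
the total: the hypotheses `Θ⁺ = Θ⁻ = Θ/2` of `…HalfStepVCTS` / `…WindowBlockCTS` / `…ClassStepCTS` from the un-split trace
bound `Θ` of `…TraceInput`.
-/

-- `Summit.<Summit>.<Problem>`: single-conjunct summit, the duplicate namespace segment is deliberate.
set_option linter.dupNamespace false

namespace Summit.AnomalousDissipation.AnomalousDissipation.Theorems.SawtoothPulseCascade.K1Window

open MeasureTheory Set Filter Topology UnitAddTorus Function Complex
open scoped Real ComplexConjugate

/-- Conjugate symmetry of the coefficients of a real function: `𝓕v(−k) = conj 𝓕v(k)`. [folklore] -/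
theorem mFourierCoeff_ofReal_neg {d : Type*} [Fintype d] [DecidableEq d] (v : UnitAddTorus d → ℝ) (k : d → ℤ) :
    mFourierCoeff (fun x => (v x : ℂ)) (-k) = conj (mFourierCoeff (fun x => (v x : ℂ)) k) := by
  simp only [mFourierCoeff, smul_eq_mul, neg_neg]
  rw [← integral_conj]
  refine integral_congr_ae (Filter.Eventually.of_forall fun x => ?_)
  simp only [map_mul, Complex.conj_ofReal, ← mFourier_neg, neg_neg]

/-- **Trace conjugation symmetry (V indexing)**: for real `v`, real even `χ`,
`Σ_{l∈[−Q,Q]} χ_l 𝓕v(l,−n) e^{2πily} = conj (Σ_{l∈[−Q,Q]} χ_l 𝓕v(l,n) e^{2πily})`. [folklore] -/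
theorem trace_neg_eq_conj_v (v : UnitAddTorus (Fin 2) → ℝ) {χ : ℤ → ℂ} (hχr : ∀ l, ∃ r : ℝ, χ l = (r : ℂ))
    (hχe : ∀ l, χ (-l) = χ l) (Q : ℕ) (n : ℤ) (y : ℝ) :
    ∑ l ∈ Finset.Icc (-(Q : ℤ)) Q, χ l * mFourierCoeff (fun x => (v x : ℂ)) ![l, -n] * cexp (2 * π * I * l * y) =
      conj (∑ l ∈ Finset.Icc (-(Q : ℤ)) Q, χ l * mFourierCoeff (fun x => (v x : ℂ)) ![l, n] * cexp (2 * π * I * l * y)) := by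
  classical
  rw [map_sum]
  -- reindex the left-hand side by `l ↦ −l`
  have hS : (Finset.Icc (-(Q : ℤ)) Q).image Neg.neg = Finset.Icc (-(Q : ℤ)) Q := by
    ext l
    simp only [Finset.mem_image, Finset.mem_Icc]
    constructor
    · rintro ⟨a, ⟨h1, h2⟩, rfl⟩; exact ⟨by linarith, by linarith⟩
    · rintro ⟨h1, h2⟩; exact ⟨-l, ⟨by linarith, by linarith⟩, neg_neg l⟩
  conv_lhs => rw [← hS, Finset.sum_image fun a _ b _ h => neg_injective h]
  refine Finset.sum_congr rfl fun l _ => ?_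
  have hk : (![-l, -n] : Fin 2 → ℤ) = -![l, n] := by
    funext i; fin_cases i <;> rfl
  obtain ⟨r, hr⟩ := hχr l
  rw [hχe, hk, mFourierCoeff_ofReal_neg, map_mul, map_mul, hr, Complex.conj_ofReal, ← Complex.exp_conj]
  congr 2
  simp only [map_mul, map_ofNat, Complex.conj_ofReal, Complex.conj_I, map_intCast]
  push_cast; ring

/-- **Trace conjugation symmetry (H indexing)**: the same with `𝓕v(−n,l)` / `𝓕v(n,l)`. [folklore] -/
theorem trace_neg_eq_conj_h (v : UnitAddTorus (Fin 2) → ℝ) {χ : ℤ → ℂ} (hχr : ∀ l, ∃ r : ℝ, χ l = (r : ℂ))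
    (hχe : ∀ l, χ (-l) = χ l) (Q : ℕ) (n : ℤ) (y : ℝ) :
    ∑ l ∈ Finset.Icc (-(Q : ℤ)) Q, χ l * mFourierCoeff (fun x => (v x : ℂ)) ![-n, l] * cexp (2 * π * I * l * y) =
      conj (∑ l ∈ Finset.Icc (-(Q : ℤ)) Q, χ l * mFourierCoeff (fun x => (v x : ℂ)) ![n, l] * cexp (2 * π * I * l * y)) := by
  classical
  rw [map_sum]
  have hS : (Finset.Icc (-(Q : ℤ)) Q).image Neg.neg = Finset.Icc (-(Q : ℤ)) Q := by
    ext l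
    simp only [Finset.mem_image, Finset.mem_Icc]
    constructor
    · rintro ⟨a, ⟨h1, h2⟩, rfl⟩; exact ⟨by linarith, by linarith⟩
    · rintro ⟨h1, h2⟩; exact ⟨-l, ⟨by linarith, by linarith⟩, neg_neg l⟩
  conv_lhs => rw [← hS, Finset.sum_image fun a _ b _ h => neg_injective h]
  refine Finset.sum_congr rfl fun l _ => ?_
  have hk : (![-n, -l] : Fin 2 → ℤ) = -![n, l] := by
    funext i; fin_cases i <;> rfl
  obtain ⟨r, hr⟩ := hχr l
  rw [hχe, hk, mFourierCoeff_ofReal_neg, map_mul, map_mul, hr, Complex.conj_ofReal, ← Complex.exp_conj]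
  congr 2
  simp only [map_mul, map_ofNat, Complex.conj_ofReal, Complex.conj_I, map_intCast]
  push_cast; ring

/-- **Halving of the trace on a sign-symmetric fibre set**: if `T (−n) = conj (T n)` for all `n` and `F = −F`, then
`Σ_{n∈F, 0<n} ‖T n‖² = Σ_{n∈F, n<0} ‖T n‖²` and each is at most half of `Σ_{n∈F} ‖T n‖²`. [folklore] -/
theorem sum_filter_pos_eq_sum_filter_neg_of_conj (T : ℤ → ℂ) (hT : ∀ n, T (-n) = conj (T n)) (F : Finset ℤ)
    (hF : ∀ n ∈ F, -n ∈ F) :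
    ∑ n ∈ F.filter (fun n => 0 < n), ‖T n‖ ^ 2 = ∑ n ∈ F.filter (fun n => n < 0), ‖T n‖ ^ 2 := by
  classical
  have hset : (F.filter fun n => n < 0) = (F.filter fun n => 0 < n).image Neg.neg := by
    ext n
    simp only [Finset.mem_filter, Finset.mem_image]
    constructor
    · rintro ⟨hn, hlt⟩; exact ⟨-n, ⟨hF n hn, by linarith⟩, neg_neg n⟩
    · rintro ⟨a, ⟨ha, hpos⟩, rfl⟩; exact ⟨hF a ha, by linarith⟩
  rw [hset, Finset.sum_image fun a _ b _ h => neg_injective h]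
  refine Finset.sum_congr rfl fun n _ => ?_
  rw [hT, Complex.norm_conj]

/-- **`Θ⁺, Θ⁻ ≤ Θ/2`**: under `T (−n) = conj (T n)` and `F = −F`, both sign halves of `Σ_{n∈F}‖T n‖²` are at most half of any
bound `Θ` of the full sum. [folklore] -/
theorem sum_filter_sign_le_half_of_conj (T : ℤ → ℂ) (hT : ∀ n, T (-n) = conj (T n)) (F : Finset ℤ)
    (hF : ∀ n ∈ F, -n ∈ F) {Θ : ℝ} (hΘ : ∑ n ∈ F, ‖T n‖ ^ 2 ≤ Θ) :
    ∑ n ∈ F.filter (fun n => 0 < n), ‖T n‖ ^ 2 ≤ Θ / 2 ∧ ∑ n ∈ F.filter (fun n => n < 0), ‖T n‖ ^ 2 ≤ Θ / 2 := by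
  classical
  have heq := sum_filter_pos_eq_sum_filter_neg_of_conj T hT F hF
  have hle : ∑ n ∈ F.filter (fun n => 0 < n), ‖T n‖ ^ 2 + ∑ n ∈ F.filter (fun n => n < 0), ‖T n‖ ^ 2 ≤
      ∑ n ∈ F, ‖T n‖ ^ 2 := by
    rw [← Finset.sum_filter_add_sum_filter_not F (fun n => 0 < n)]
    refine add_le_add le_rfl (Finset.sum_le_sum_of_subset_of_nonneg ?_ fun n _ _ => sq_nonneg _)
    intro n hn
    obtain ⟨hnF, hlt⟩ := Finset.mem_filter.mp hn
    exact Finset.mem_filter.mpr ⟨hnF, by linarith⟩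
  constructor <;> linarith

/-- **The sign-split trace bounds for a real input, V indexing**: if `Σ_{n∈F} |T_n(y)|² ≤ Θ` with
`T_n(y) = Σ_{l∈[−Q,Q]} χ_l 𝓕v(l,n) e^{2πily}`, `v` real, `χ` real and even, `F = −F`, then the positive and negative halves
are `≤ Θ/2` each — the `hΘp`/`hΘm` of `…HalfStepVCTS.sum_window_sq_norm_vstep_ct_split_le` with `Θp = Θm = Θ/2`. [folklore] -/
theorem sum_sq_trace_sign_le_half_v (v : UnitAddTorus (Fin 2) → ℝ) {χ : ℤ → ℂ} (hχr : ∀ l, ∃ r : ℝ, χ l = (r : ℂ))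
    (hχe : ∀ l, χ (-l) = χ l) (Q : ℕ) (F : Finset ℤ) (hF : ∀ n ∈ F, -n ∈ F) (y : ℝ) {Θ : ℝ}
    (hΘ : ∑ n ∈ F, ‖∑ l ∈ Finset.Icc (-(Q : ℤ)) Q, χ l * mFourierCoeff (fun x => (v x : ℂ)) ![l, n] *
      cexp (2 * π * I * l * y)‖ ^ 2 ≤ Θ) :
    ∑ n ∈ F.filter (fun n => 0 < n), ‖∑ l ∈ Finset.Icc (-(Q : ℤ)) Q, χ l * mFourierCoeff (fun x => (v x : ℂ)) ![l, n] *
        cexp (2 * π * I * l * y)‖ ^ 2 ≤ Θ / 2 ∧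
      ∑ n ∈ F.filter (fun n => n < 0), ‖∑ l ∈ Finset.Icc (-(Q : ℤ)) Q, χ l * mFourierCoeff (fun x => (v x : ℂ)) ![l, n] *
        cexp (2 * π * I * l * y)‖ ^ 2 ≤ Θ / 2 :=
  sum_filter_sign_le_half_of_conj (fun n => ∑ l ∈ Finset.Icc (-(Q : ℤ)) Q,
    χ l * mFourierCoeff (fun x => (v x : ℂ)) ![l, n] * cexp (2 * π * I * l * y))
    (fun n => trace_neg_eq_conj_v v hχr hχe Q n y) F hF hΘ

/-- **The sign-split trace bounds for a real input, H indexing** (`𝓕v(n,l)`): both halves `≤ Θ/2` — the `hΘp`/`hΘm` of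
`…HalfStepHCTS.sum_window_sq_norm_hstep_ct_split_le`. [folklore] -/
theorem sum_sq_trace_sign_le_half_h (v : UnitAddTorus (Fin 2) → ℝ) {χ : ℤ → ℂ} (hχr : ∀ l, ∃ r : ℝ, χ l = (r : ℂ))
    (hχe : ∀ l, χ (-l) = χ l) (Q : ℕ) (F : Finset ℤ) (hF : ∀ n ∈ F, -n ∈ F) (y : ℝ) {Θ : ℝ}
    (hΘ : ∑ n ∈ F, ‖∑ l ∈ Finset.Icc (-(Q : ℤ)) Q, χ l * mFourierCoeff (fun x => (v x : ℂ)) ![n, l] *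
      cexp (2 * π * I * l * y)‖ ^ 2 ≤ Θ) :
    ∑ n ∈ F.filter (fun n => 0 < n), ‖∑ l ∈ Finset.Icc (-(Q : ℤ)) Q, χ l * mFourierCoeff (fun x => (v x : ℂ)) ![n, l] *
        cexp (2 * π * I * l * y)‖ ^ 2 ≤ Θ / 2 ∧
      ∑ n ∈ F.filter (fun n => n < 0), ‖∑ l ∈ Finset.Icc (-(Q : ℤ)) Q, χ l * mFourierCoeff (fun x => (v x : ℂ)) ![n, l] *
        cexp (2 * π * I * l * y)‖ ^ 2 ≤ Θ / 2 :=
  sum_filter_sign_le_half_of_conj (fun n => ∑ l ∈ Finset.Icc (-(Q : ℤ)) Q,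
    χ l * mFourierCoeff (fun x => (v x : ℂ)) ![n, l] * cexp (2 * π * I * l * y))
    (fun n => trace_neg_eq_conj_h v hχr hχe Q n y) F hF hΘ

end Summit.AnomalousDissipation.AnomalousDissipation.Theorems.SawtoothPulseCascade.K1Window
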